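import Summits.BirchSwinnertonDyer.BirchSwinnertonDyer.Theorems.ResidualThetaTransportAtTwoThetaLayerLambdaCongruenceAtTwoWSideLayerZero
import Summits.BirchSwinnertonDyer.BirchSwinnertonDyer.Theorems.ResidualThetaTransportAtTwoThetaLayerLambdaCongruenceAtTwoDepletionExact
import Summits.BirchSwinnertonDyer.BirchSwinnertonDyer.Theorems.ResidualThetaTransportAtTwoThetaLayerLambdaCongruenceAtTwoResidualReduction
import HarnessLib

/-!
# Crux `ThetaLayerLambdaCongruenceAtTwo` (stmt-BirchSwinnertonDyer-20688), line `birth`: the curve-side DEPLETION EULER FACTORS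
# have UNIT CONTENT and BOUNDED `λ` at all large layers (input of «(μ-W₀) ⟹ (μ-W₁)», companion file `…CurveMuUndepleted`)

Lead prover bsd-wall-rtt-p3 g7 (`--supports stmt-BirchSwinnertonDyer-20688`; closes nothing). THEOREMS ONLY, no definition;
nothing about any curve or form is asserted; BSD is not proved by any of this.

The crux's `W`-side depletion Euler factor at an odd place `v` and layer `n` is `E_{v,n} = L_v(W, ℓ_v⁻¹(1+X)^{e_v(n)})` with
`L_v(W,X) = 1 + bX + cX² ∈ ℤ[X]` the local polynomial (`coeff_zero_localPolynomialAt`, degree `≤ 2`) and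
`e_v(n) = (−f_{ℓ_v} mod 2ⁿ) ∈ [0, 2ⁿ)`, `f_ℓ ∈ ℤ₂` the Frobenius exponent (`γ^{f_ℓ} = ⟨ℓ⟩`). This file proves:

* §1 `choose_two_pow_mul_two_pow_odd`: `C(2^s·u, 2^s)` is odd for `u` odd (one step of Lucas).
* §2 `norm_intCast_padicAlgCl_two_eq_one_of_odd`: an odd integer is a `2`-adic unit in `ℚ̄₂`.
* §3 `coeff_wEulerFactor` (`coeff_j E = 𝟙_{j=0} + bℓ⁻¹C(e,j) + cℓ⁻²C(2e,j)`), `exists_norm_coeff_wEulerFactor_eq_one` (for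
  `e = 2^s·u`, `u` odd, a UNIT coefficient in degree `0`, `2^s` or `2^{s+1}` according to the parities of `b, c`), hence
  `wEulerFactor_ne_zero_supNorm_eq_one_layerLambda_le`: `E ≠ 0`, `‖E‖_sup = 1`, `λ(E) ≤ 2^{s+1}` — Greenberg–Vatsal's
  remark that the imprimitive Euler factors have `μ`-invariant zero, made effective in `λ` at `p = 2`.
* §4 `prod_ne_zero_supNorm_eq_one_layerLambda_le`: finite products keep unit content, `λ` adds up (Gauss's lemma).
* §5 `frobeniusExponent_two_natCast_ne_zero` (`f_ℓ ≠ 0` for an odd prime `ℓ`: `ℓ ∈ ℤ₂ˣ` has infinite order),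
  `exists_not_mem_span_two_pow`, `not_pow_dvd_val_toZModPow`: if `x ∉ 2^{t+1}ℤ₂` then `2^{t+1} ∤ (x mod 2ⁿ)` for all
  `n ≥ t+1` — so `e_v(n) = 2^s·u` with `s ≤ t_v` bounded independently of `n`, and `λ(E_{v,n}) ≤ 2^{t_v+1}`.

References: [GreenbergVatsal2000] §1 p. 9 (display (8)–(10): `P_ℓ(ℓ⁻¹γ_ℓ)`, `f_ℓ`; the Euler factors have `μ = 0`);
[PollackWeston2011MT] §3.1 (λ, μ in the layers); [SilvermanAEC2009] C.§16 (`L_v = 1 − a_vT + q_vT²`).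
-/

noncomputable section

-- justification: the `Summit.BirchSwinnertonDyer.BirchSwinnertonDyer.…` path repeats a component (route-file convention)
set_option linter.dupNamespace false

open scoped Classical

open Polynomial

open Literature.NumberTheory.IwasawaTheory Literature.NumberTheory.EllipticCurves
  Literature.NumberTheory.EllipticCurves.ModularForms

namespace Summit.BirchSwinnertonDyer.BirchSwinnertonDyer.Theorems.ThetaLayerLambdaCongruenceAtTwo

/-! ## §1. One step of Lucas: `C(2^s·u, 2^s)` is odd for `u` odd -/

/-- `C(2^s·u, 2^s)` is odd when `u` is odd (Lucas' theorem mod `2`, by induction on `s`). [folklore] -/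
theorem choose_two_pow_mul_two_pow_odd {u : ℕ} (hu : Odd u) (s : ℕ) : Odd ((2 ^ s * u).choose (2 ^ s)) := by
  induction s with
  | zero => simpa using hu
  | succ s ih =>
    haveI : Fact (Nat.Prime 2) := ⟨Nat.prime_two⟩
    have h := Choose.choose_modEq_choose_mod_mul_choose_div_nat (n := 2 ^ (s + 1) * u) (k := 2 ^ (s + 1)) (p := 2)
    have h1 : 2 ^ (s + 1) * u % 2 = 0 := by
      rw [pow_succ]; exact Nat.mod_eq_zero_of_dvd ⟨2 ^ s * u, by ring⟩
    have h2 : 2 ^ (s + 1) % 2 = 0 := by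
      rw [pow_succ]; exact Nat.mod_eq_zero_of_dvd ⟨2 ^ s, by ring⟩
    have h3 : 2 ^ (s + 1) * u / 2 = 2 ^ s * u := by
      rw [show 2 ^ (s + 1) * u = 2 ^ s * u * 2 by ring, Nat.mul_div_cancel _ two_pos]
    have h4 : 2 ^ (s + 1) / 2 = 2 ^ s := by
      rw [pow_succ, Nat.mul_div_cancel _ two_pos]
    rw [h1, h2, h3, h4, Nat.choose_zero_right, one_mul] at h
    rw [Nat.odd_iff] at ih ⊢
    rw [Nat.ModEq] at h
    rw [h, ih]

/-! ## §2. `2`-adic norms of odd integers in `ℚ̄₂` -/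

/-- `‖(z : ℚ̄₂)‖ = 1` for an ODD integer `z` (an even integer has norm `< 1`, tree lemma
`norm_intCast_padicAlgCl_two_le_one`; ultrametric sum with `1`). [folklore] -/
theorem norm_intCast_padicAlgCl_two_eq_one_of_odd {z : ℤ} (hz : Odd z) : ‖(z : PadicAlgCl 2)‖ = 1 := by
  obtain ⟨k, rfl⟩ := hz
  have h2k : ‖((2 * k : ℤ) : PadicAlgCl 2)‖ < 1 := by
    rw [Int.cast_mul, Int.cast_ofNat, norm_mul]
    calc ‖(2 : PadicAlgCl 2)‖ * ‖(k : PadicAlgCl 2)‖ ≤ ‖(2 : PadicAlgCl 2)‖ * 1 :=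
          mul_le_mul_of_nonneg_left (norm_intCast_padicAlgCl_two_le_one k) (norm_nonneg _)
      _ < 1 := by rw [mul_one]; exact norm_two_padicAlgCl_lt_one
  have hne : ‖((2 * k : ℤ) : PadicAlgCl 2)‖ ≠ ‖(1 : PadicAlgCl 2)‖ := by rw [norm_one]; exact h2k.ne
  rw [Int.cast_add, Int.cast_one, IsUltrametricDist.norm_add_eq_max_of_norm_ne_norm hne, norm_one]
  exact max_eq_right h2k.le

/-! ## §3. The depletion Euler factor at an odd place: unit content and bounded `λ` -/

section Euler

variable (W : WeierstrassCurve ℚ) (v : IsDedekindDomain.HeightOneSpectrum (NumberField.RingOfIntegers ℚ))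

/-- The local polynomial of `W` at `v` is `1 + bX + cX²` with `b = coeff 1`, `c = coeff 2` (constant term `1`, degree `≤ 2`).
[cite: SilvermanAEC2009, C.§16 (L_v = 1 − a_v T + q_v T², degree ≤ 2, constant term 1)] -/
theorem localPolynomialAt_eq_one_add :
    W.localPolynomialAt v = C 1 + C ((W.localPolynomialAt v).coeff 1) * X + C ((W.localPolynomialAt v).coeff 2) * X ^ 2 := by
  have hdeg : (W.localPolynomialAt v).natDegree < 3 :=
    lt_of_le_of_lt (WeierstrassCurve.natDegree_localPolynomial_le_two _) (by norm_num)
  have h := (W.localPolynomialAt v).as_sum_range' 3 hdeg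
  rw [Finset.sum_range_succ, Finset.sum_range_succ, Finset.sum_range_succ, Finset.sum_range_zero, zero_add,
    W.coeff_zero_localPolynomialAt v, ← C_mul_X_pow_eq_monomial, ← C_mul_X_pow_eq_monomial, ← C_mul_X_pow_eq_monomial,
    pow_zero, mul_one, pow_one] at h
  exact h

/-- **Coefficients of the depletion Euler factor** `E = L_v(W, ℓ⁻¹(X+1)^e)`: with `L_v = 1 + bX + cX²`,
`coeff_j E = 𝟙_{j=0} + b ℓ⁻¹ C(e,j) + c ℓ⁻² C(2e,j)`. [cite: GreenbergVatsal2000, §1 (8) (the imprimitive Euler factors P_ℓ(ℓ⁻¹γ_ℓ))] -/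
theorem coeff_wEulerFactor (e j : ℕ) :
    (((W.localPolynomialAt v).map (Int.castRingHom (PadicAlgCl 2))).comp
        (C ((Rat.HeightOneSpectrum.natGenerator v : PadicAlgCl 2)⁻¹) * (X + 1) ^ e)).coeff j =
      (if j = 0 then 1 else 0) +
        (((W.localPolynomialAt v).coeff 1 : ℤ) : PadicAlgCl 2) * ((Rat.HeightOneSpectrum.natGenerator v : PadicAlgCl 2)⁻¹ *
          (e.choose j : PadicAlgCl 2)) +
        (((W.localPolynomialAt v).coeff 2 : ℤ) : PadicAlgCl 2) *
          (((Rat.HeightOneSpectrum.natGenerator v : PadicAlgCl 2)⁻¹) ^ 2 * ((2 * e).choose j : PadicAlgCl 2)) := by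
  set ℓ : PadicAlgCl 2 := (Rat.HeightOneSpectrum.natGenerator v : PadicAlgCl 2) with hℓ
  set b : ℤ := (W.localPolynomialAt v).coeff 1 with hb
  set c : ℤ := (W.localPolynomialAt v).coeff 2 with hc
  have hmap : (W.localPolynomialAt v).map (Int.castRingHom (PadicAlgCl 2)) =
      C 1 + C (b : PadicAlgCl 2) * X + C (c : PadicAlgCl 2) * X ^ 2 := by
    conv_lhs => rw [localPolynomialAt_eq_one_add W v]
    rw [Polynomial.map_add, Polynomial.map_add, Polynomial.map_mul, Polynomial.map_mul, Polynomial.map_pow,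
      Polynomial.map_C, Polynomial.map_C, Polynomial.map_C, map_X, map_one, eq_intCast, eq_intCast]
  have hcomp : ((W.localPolynomialAt v).map (Int.castRingHom (PadicAlgCl 2))).comp (C ℓ⁻¹ * (X + 1) ^ e) =
      C 1 + C ((b : PadicAlgCl 2) * ℓ⁻¹) * (X + 1) ^ e + C ((c : PadicAlgCl 2) * (ℓ⁻¹) ^ 2) * (X + 1) ^ (2 * e) := by
    rw [hmap, add_comp, add_comp, mul_comp, mul_comp, C_comp, C_comp, C_comp, X_comp, pow_comp, X_comp, mul_pow,
      ← C_pow, ← pow_mul, map_mul, map_mul, mul_comm e 2]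
    ring
  rw [hcomp, coeff_add, coeff_add, coeff_C, coeff_C_mul, coeff_C_mul, coeff_X_add_one_pow, coeff_X_add_one_pow]
  split_ifs <;> ring

variable {v}

/-- **The depletion Euler factor has a UNIT coefficient in degree `≤ 2^{s+1}`** when its exponent is `e = 2^s·u`, `u` odd
(`v` an odd place): with `L_v = 1 + bX + cX²`, the unit sits at `X^0` if `b ≡ c (mod 2)`, at `X^{2^s}` if `b` is odd and
`c` even (`C(2^s u, 2^s)` odd), at `X^{2^{s+1}}` if `b` is even and `c` odd (`C(2^{s+1}u, 2^{s+1})` odd).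
[cite: GreenbergVatsal2000, §1 p. 9 (the Euler factors P_ℓ(ℓ⁻¹γ_ℓ) have μ-invariant 0)] -/
theorem exists_norm_coeff_wEulerFactor_eq_one (hv : ((2 : ℕ) : NumberField.RingOfIntegers ℚ) ∉ v.asIdeal)
    {s u : ℕ} (hu : Odd u) :
    ∃ j ≤ 2 ^ (s + 1), ‖(((W.localPolynomialAt v).map (Int.castRingHom (PadicAlgCl 2))).comp
        (C ((Rat.HeightOneSpectrum.natGenerator v : PadicAlgCl 2)⁻¹) * (X + 1) ^ (2 ^ s * u))).coeff j‖ = 1 := by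
  set ℓn : ℕ := Rat.HeightOneSpectrum.natGenerator v with hℓn
  have hℓodd : ¬ 2 ∣ ℓn := not_two_dvd_natGenerator hv
  have hℓoddZ : Odd (ℓn : ℤ) := by exact_mod_cast Nat.odd_iff.mpr (Nat.two_dvd_ne_zero.mp hℓodd)
  have hℓnorm : ‖(ℓn : PadicAlgCl 2)‖ = 1 := norm_natCast_padicAlgCl_two_eq_one hℓodd
  have hℓne : (ℓn : PadicAlgCl 2) ≠ 0 := fun h ↦ by rw [h, norm_zero] at hℓnorm; exact zero_ne_one hℓnorm
  have hℓinv : ‖(ℓn : PadicAlgCl 2)⁻¹‖ = 1 := by rw [norm_inv, hℓnorm, inv_one]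
  set b : ℤ := (W.localPolynomialAt v).coeff 1 with hb
  set c : ℤ := (W.localPolynomialAt v).coeff 2 with hc
  -- even integers are small, natural numbers are integral
  have hev : ∀ {z : ℤ}, Even z → ‖(z : PadicAlgCl 2)‖ < 1 := fun {z} hz ↦ by
    obtain ⟨k, rfl⟩ := hz
    rw [show ((k + k : ℤ) : PadicAlgCl 2) = 2 * (k : PadicAlgCl 2) by push_cast; ring, norm_mul]
    calc ‖(2 : PadicAlgCl 2)‖ * ‖(k : PadicAlgCl 2)‖ ≤ ‖(2 : PadicAlgCl 2)‖ * 1 :=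
          mul_le_mul_of_nonneg_left (norm_intCast_padicAlgCl_two_le_one k) (norm_nonneg _)
      _ < 1 := by rw [mul_one]; exact norm_two_padicAlgCl_lt_one
  have hnat : ∀ m : ℕ, ‖(m : PadicAlgCl 2)‖ ≤ 1 := fun m ↦ by
    rw [← Int.cast_natCast]; exact norm_intCast_padicAlgCl_two_le_one _
  -- the two odd binomial coefficients
  have hK1 : ‖((2 ^ s * u).choose (2 ^ s) : PadicAlgCl 2)‖ = 1 :=
    norm_natCast_padicAlgCl_two_eq_one (choose_two_pow_mul_two_pow_odd hu s).not_two_dvd_nat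
  have hK2 : ‖((2 * (2 ^ s * u)).choose (2 ^ (s + 1)) : PadicAlgCl 2)‖ = 1 := by
    rw [show 2 * (2 ^ s * u) = 2 ^ (s + 1) * u by ring]
    exact norm_natCast_padicAlgCl_two_eq_one (choose_two_pow_mul_two_pow_odd hu (s + 1)).not_two_dvd_nat
  rcases Int.even_or_odd b with hbe | hbo <;> rcases Int.even_or_odd c with hce | hco
  · -- b, c even: the constant coefficient is a unit
    refine ⟨0, Nat.zero_le _, ?_⟩
    rw [coeff_wEulerFactor, if_pos rfl, Nat.choose_zero_right, Nat.choose_zero_right, Nat.cast_one, mul_one, mul_one,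
      add_assoc]
    have hsmall : ‖(b : PadicAlgCl 2) * (ℓn : PadicAlgCl 2)⁻¹ + (c : PadicAlgCl 2) * ((ℓn : PadicAlgCl 2)⁻¹) ^ 2‖ < 1 := by
      refine lt_of_le_of_lt (IsUltrametricDist.norm_add_le_max _ _) (max_lt ?_ ?_)
      · rw [norm_mul, hℓinv, mul_one]; exact hev hbe
      · rw [norm_mul, norm_pow, hℓinv, one_pow, mul_one]; exact hev hce
    have hne : ‖(1 : PadicAlgCl 2)‖ ≠
        ‖(b : PadicAlgCl 2) * (ℓn : PadicAlgCl 2)⁻¹ + (c : PadicAlgCl 2) * ((ℓn : PadicAlgCl 2)⁻¹) ^ 2‖ := by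
      rw [norm_one]; exact (ne_of_lt hsmall).symm
    rw [IsUltrametricDist.norm_add_eq_max_of_norm_ne_norm hne, norm_one]
    exact max_eq_left hsmall.le
  · -- b even, c odd: the coefficient of X^{2^{s+1}} is a unit
    refine ⟨2 ^ (s + 1), le_rfl, ?_⟩
    rw [coeff_wEulerFactor, if_neg (pow_ne_zero _ two_ne_zero), zero_add]
    have h1 : ‖(b : PadicAlgCl 2) * ((ℓn : PadicAlgCl 2)⁻¹ * ((2 ^ s * u).choose (2 ^ (s + 1)) : PadicAlgCl 2))‖ < 1 := by
      rw [norm_mul, norm_mul, hℓinv, one_mul]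
      calc ‖(b : PadicAlgCl 2)‖ * ‖((2 ^ s * u).choose (2 ^ (s + 1)) : PadicAlgCl 2)‖ ≤ ‖(b : PadicAlgCl 2)‖ * 1 :=
            mul_le_mul_of_nonneg_left (hnat _) (norm_nonneg _)
        _ < 1 := by rw [mul_one]; exact hev hbe
    have h2 : ‖(c : PadicAlgCl 2) * (((ℓn : PadicAlgCl 2)⁻¹) ^ 2 * ((2 * (2 ^ s * u)).choose (2 ^ (s + 1)) : PadicAlgCl 2))‖
        = 1 := by
      rw [norm_mul, norm_mul, norm_pow, hℓinv, one_pow, one_mul, hK2, mul_one]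
      exact norm_intCast_padicAlgCl_two_eq_one_of_odd hco
    have hne : ‖(b : PadicAlgCl 2) * ((ℓn : PadicAlgCl 2)⁻¹ * ((2 ^ s * u).choose (2 ^ (s + 1)) : PadicAlgCl 2))‖ ≠
        ‖(c : PadicAlgCl 2) * (((ℓn : PadicAlgCl 2)⁻¹) ^ 2 * ((2 * (2 ^ s * u)).choose (2 ^ (s + 1)) : PadicAlgCl 2))‖ := by
      rw [h2]; exact ne_of_lt h1
    rw [IsUltrametricDist.norm_add_eq_max_of_norm_ne_norm hne, h2]
    exact max_eq_right h1.le
  · -- b odd, c even: the coefficient of X^{2^s} is a unit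
    refine ⟨2 ^ s, Nat.pow_le_pow_right two_pos (Nat.le_succ s), ?_⟩
    rw [coeff_wEulerFactor, if_neg (pow_ne_zero _ two_ne_zero), zero_add]
    have h1 : ‖(b : PadicAlgCl 2) * ((ℓn : PadicAlgCl 2)⁻¹ * ((2 ^ s * u).choose (2 ^ s) : PadicAlgCl 2))‖ = 1 := by
      rw [norm_mul, norm_mul, hℓinv, one_mul, hK1, mul_one]
      exact norm_intCast_padicAlgCl_two_eq_one_of_odd hbo
    have h2 : ‖(c : PadicAlgCl 2) * (((ℓn : PadicAlgCl 2)⁻¹) ^ 2 * ((2 * (2 ^ s * u)).choose (2 ^ s) : PadicAlgCl 2))‖ < 1 := by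
      rw [norm_mul, norm_mul, norm_pow, hℓinv, one_pow, one_mul]
      calc ‖(c : PadicAlgCl 2)‖ * ‖((2 * (2 ^ s * u)).choose (2 ^ s) : PadicAlgCl 2)‖ ≤ ‖(c : PadicAlgCl 2)‖ * 1 :=
            mul_le_mul_of_nonneg_left (hnat _) (norm_nonneg _)
        _ < 1 := by rw [mul_one]; exact hev hce
    have hne : ‖(b : PadicAlgCl 2) * ((ℓn : PadicAlgCl 2)⁻¹ * ((2 ^ s * u).choose (2 ^ s) : PadicAlgCl 2))‖ ≠
        ‖(c : PadicAlgCl 2) * (((ℓn : PadicAlgCl 2)⁻¹) ^ 2 * ((2 * (2 ^ s * u)).choose (2 ^ s) : PadicAlgCl 2))‖ := by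
      rw [h1]; exact (ne_of_lt h2).symm
    rw [IsUltrametricDist.norm_add_eq_max_of_norm_ne_norm hne, h1]
    exact max_eq_left h2.le
  · -- b, c odd: the constant coefficient is `(ℓ² + bℓ + c)/ℓ²`, an odd integer over a unit
    refine ⟨0, Nat.zero_le _, ?_⟩
    rw [coeff_wEulerFactor, if_pos rfl, Nat.choose_zero_right, Nat.choose_zero_right, Nat.cast_one, mul_one, mul_one]
    have hodd : Odd ((ℓn : ℤ) ^ 2 + b * ℓn + c) := by
      have h1 : Odd ((ℓn : ℤ) ^ 2) := hℓoddZ.pow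
      have h2 : Odd (b * (ℓn : ℤ)) := hbo.mul hℓoddZ
      exact (h1.add_odd h2).add_odd hco
    have heq : (1 : PadicAlgCl 2) + (b : PadicAlgCl 2) * (ℓn : PadicAlgCl 2)⁻¹ + (c : PadicAlgCl 2) * ((ℓn : PadicAlgCl 2)⁻¹) ^ 2
        = (((ℓn : ℤ) ^ 2 + b * ℓn + c : ℤ) : PadicAlgCl 2) * ((ℓn : PadicAlgCl 2)⁻¹) ^ 2 := by
      push_cast
      field_simp
    rw [heq, norm_mul, norm_pow, hℓinv, one_pow, mul_one]
    exact norm_intCast_padicAlgCl_two_eq_one_of_odd hodd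

/-- **Unit content and bounded `λ` of the depletion Euler factor**: for an odd place `v` and an exponent `e = 2^s·u` with
`u` odd, `E = L_v(W, ℓ_v⁻¹(X+1)^e)` is non-zero, `‖E‖_sup = 1`, and `λ(E) ≤ 2^{s+1}`.
[cite: GreenbergVatsal2000, §1 p. 9 (the Euler factors P_ℓ(ℓ⁻¹γ_ℓ) have μ-invariant 0)] -/
theorem wEulerFactor_ne_zero_supNorm_eq_one_layerLambda_le (hv : ((2 : ℕ) : NumberField.RingOfIntegers ℚ) ∉ v.asIdeal)
    {s u : ℕ} (hu : Odd u) :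
    ((W.localPolynomialAt v).map (Int.castRingHom (PadicAlgCl 2))).comp
        (C ((Rat.HeightOneSpectrum.natGenerator v : PadicAlgCl 2)⁻¹) * (X + 1) ^ (2 ^ s * u)) ≠ 0 ∧
      (((W.localPolynomialAt v).map (Int.castRingHom (PadicAlgCl 2))).comp
        (C ((Rat.HeightOneSpectrum.natGenerator v : PadicAlgCl 2)⁻¹) * (X + 1) ^ (2 ^ s * u))).supNorm = 1 ∧
      layerLambda (((W.localPolynomialAt v).map (Int.castRingHom (PadicAlgCl 2))).comp
        (C ((Rat.HeightOneSpectrum.natGenerator v : PadicAlgCl 2)⁻¹) * (X + 1) ^ (2 ^ s * u))) ≤ 2 ^ (s + 1) := by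
  obtain ⟨j, hj, hnorm⟩ := exists_norm_coeff_wEulerFactor_eq_one W hv hu (s := s)
  have hle := supNorm_wEulerFactor_le_one (W := W) v hv (2 ^ s * u)
  have hsup : (((W.localPolynomialAt v).map (Int.castRingHom (PadicAlgCl 2))).comp
      (C ((Rat.HeightOneSpectrum.natGenerator v : PadicAlgCl 2)⁻¹) * (X + 1) ^ (2 ^ s * u))).supNorm = 1 :=
    le_antisymm hle (hnorm ▸ le_supNorm _ j)
  refine ⟨fun h0 ↦ ?_, hsup, ?_⟩
  · rw [h0, coeff_zero, norm_zero] at hnorm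
    exact zero_ne_one hnorm
  · refine le_trans ?_ hj
    rw [layerLambda_def]
    exact Nat.sInf_le (by rw [Set.mem_setOf_eq, hnorm, hsup])

end Euler


/-! ## §4. Products of unit-content polynomials with bounded `λ` -/

section Products

variable {K : Type*} [NormedField K] [IsUltrametricDist K]

omit [IsUltrametricDist K] in
/-- `λ(1) = 0`. [folklore] -/
theorem layerLambda_one : layerLambda (1 : K[X]) = 0 := by
  rw [layerLambda_eq_iff]
  refine ⟨?_, fun j hj ↦ absurd hj (Nat.not_lt_zero j)⟩
  apply le_antisymm (le_supNorm _ 0)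
  rw [← C_1, supNorm_C, coeff_C_zero]

/-- A finite product of non-zero polynomials of sup norm `1` with `λ ≤ B_i` is non-zero, has sup norm `1` and
`λ ≤ ∑ B_i` (Gauss's lemma / additivity of `λ`, `supNorm_mul_and_layerLambda_mul`). [folklore] -/
theorem prod_ne_zero_supNorm_eq_one_layerLambda_le {ι : Type*} (s : Finset ι) (E : ι → K[X]) (B : ι → ℕ)
    (h : ∀ i ∈ s, E i ≠ 0 ∧ (E i).supNorm = 1 ∧ layerLambda (E i) ≤ B i) :
    (∏ i ∈ s, E i) ≠ 0 ∧ (∏ i ∈ s, E i).supNorm = 1 ∧ layerLambda (∏ i ∈ s, E i) ≤ ∑ i ∈ s, B i := by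
  classical
  induction s using Finset.induction_on with
  | empty =>
    refine ⟨by simp, ?_, ?_⟩
    · rw [Finset.prod_empty, ← C_1, supNorm_C, norm_one]
    · rw [Finset.prod_empty, Finset.sum_empty, layerLambda_one]
  | insert a s ha ih =>
    have hall : ∀ i ∈ s, E i ≠ 0 ∧ (E i).supNorm = 1 ∧ layerLambda (E i) ≤ B i :=
      fun i hi ↦ h i (Finset.mem_insert_of_mem hi)
    obtain ⟨hne, hsup, hlam⟩ := ih hall
    obtain ⟨hane, hasup, halam⟩ := h a (Finset.mem_insert_self a s)
    obtain ⟨hmsup, hmlam⟩ := supNorm_mul_and_layerLambda_mul hane hne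
    rw [Finset.prod_insert ha, Finset.sum_insert ha]
    exact ⟨mul_ne_zero hane hne, by rw [hmsup, hasup, hsup, one_mul], by rw [hmlam]; exact Nat.add_le_add halam hlam⟩

end Products

/-! ## §5. The Frobenius exponent of an odd prime is non-zero; its reductions have bounded `2`-adic valuation -/

section Frobenius

/-- For an odd prime `ℓ`, the Frobenius exponent `f_ℓ ∈ ℤ₂` (`γ^{f_ℓ} = ⟨ℓ⟩`) is non-zero: `ℓ ∈ ℤ₂ˣ` is not of finite
order (`ℓ^k = 1` forces `ℓ = 1`). [cite: GreenbergVatsal2000, §1 p. 9 (definition of f_ℓ)] -/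
theorem frobeniusExponent_two_natCast_ne_zero {ℓ : ℕ} (hℓ : ℓ.Prime) (hℓ2 : ¬ 2 ∣ ℓ) :
    GreenbergVatsal2000.frobeniusExponent 2 (ℓ : ℤ_[2]) ≠ 0 := by
  have hunit : IsUnit (ℓ : ℤ_[2]) := by
    rw [PadicInt.isUnit_iff, PadicInt.norm_natCast_eq_one_iff]
    exact (Nat.Prime.coprime_iff_not_dvd Nat.prime_two).mpr hℓ2
  rw [GreenbergVatsal2000.frobeniusExponent_of_isUnit hunit, Ne, CyclotomicZp.ell_eq_zero_iff,
    isOfFinOrder_iff_pow_eq_one]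
  rintro ⟨k, hk, hpow⟩
  have h1 : ((hunit.unit ^ k : ℤ_[2]ˣ) : ℤ_[2]) = ((ℓ ^ k : ℕ) : ℤ_[2]) := by
    rw [Units.val_pow_eq_pow_val, IsUnit.unit_spec, Nat.cast_pow]
  rw [hpow, Units.val_one] at h1
  have h2 : ℓ ^ k = 1 := by exact_mod_cast h1.symm
  rcases Nat.pow_eq_one.mp h2 with h | h
  · exact hℓ.one_lt.ne' h
  · exact hk.ne' h

/-- A non-zero `x ∈ ℤ₂` lies outside some `2^{t+1}ℤ₂`. [folklore] -/
theorem exists_not_mem_span_two_pow {x : ℤ_[2]} (hx : x ≠ 0) : ∃ t : ℕ, x ∉ Ideal.span {(2 : ℤ_[2]) ^ (t + 1)} := by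
  by_contra h
  push Not at h
  apply hx
  rw [← norm_eq_zero]
  refine le_antisymm (le_of_forall_pos_lt_add fun ε hε ↦ ?_) (norm_nonneg _)
  obtain ⟨t, ht⟩ := exists_pow_lt_of_lt_one hε (by norm_num : ((2 : ℝ)⁻¹) < 1)
  have hle : ‖x‖ ≤ (2 : ℝ) ^ (-((t + 1 : ℕ) : ℤ)) := by
    have := (PadicInt.norm_le_pow_iff_mem_span_pow x (t + 1)).mpr (by exact_mod_cast h t)
    exact_mod_cast this
  calc ‖x‖ ≤ (2 : ℝ) ^ (-((t + 1 : ℕ) : ℤ)) := hle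
    _ ≤ ((2 : ℝ)⁻¹) ^ t := by
        rw [zpow_neg, zpow_natCast, ← inv_pow]
        exact pow_le_pow_of_le_one (by norm_num) (by norm_num) (Nat.le_succ t)
    _ < ε := ht
    _ ≤ 0 + ε := by rw [zero_add]

/-- **Bounded valuation of the layer exponents**: if `x ∉ 2^{t+1}ℤ₂` then for every `n ≥ t+1` the representative
`(x mod 2ⁿ) ∈ [0, 2ⁿ)` is not divisible by `2^{t+1}` (compatibility of the reductions `ℤ₂ → ℤ/2ⁿ → ℤ/2^{t+1}`).
[folklore] -/
theorem not_pow_dvd_val_toZModPow {x : ℤ_[2]} {t : ℕ} (hx : x ∉ Ideal.span {(2 : ℤ_[2]) ^ (t + 1)}) {n : ℕ}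
    (hn : t + 1 ≤ n) : ¬ 2 ^ (t + 1) ∣ (PadicInt.toZModPow n x).val := by
  intro hdvd
  apply hx
  rw [show (2 : ℤ_[2]) ^ (t + 1) = ((2 : ℕ) : ℤ_[2]) ^ (t + 1) by norm_cast, ← PadicInt.ker_toZModPow, RingHom.mem_ker, ← PadicInt.zmod_cast_comp_toZModPow (t + 1) n hn,
    RingHom.comp_apply, ZMod.castHom_apply, ZMod.cast_eq_val, ZMod.natCast_eq_zero_iff]
  exact hdvd

end Frobenius


end Summit.BirchSwinnertonDyer.BirchSwinnertonDyer.Theorems.ThetaLayerLambdaCongruenceAtTwo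

end
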